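import Summits.AtomisticToContinuum.BoseEinsteinCondensation.Theses.BECBathMassLiouville
import Summits.AtomisticToContinuum.BoseEinsteinCondensation.Theses.BECInsertionCorrector
import Summits.AtomisticToContinuum.BoseEinsteinCondensation.Theorems.BECBathMassLiouvilleResidueCondensesAll
import Summits.AtomisticToContinuum.BoseEinsteinCondensation.Theorems.BECBathMassLiouvilleResponseLiouvilleGlue
import Summits.AtomisticToContinuum.BoseEinsteinCondensation.Theorems.BECInsertionCorrectorCorrectorClosureFactorisationExact
import Summits.AtomisticToContinuum.BoseEinsteinCondensation.Theorems.StaticResponseBound.Negative.Basic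
import HarnessLib

/-!
# Costume certificate for crux `SpaceTimeLiouville` (stmt-AtomisticToContinuum-13801) — strategist r1, 2026-08-17

Route `BECBathMassLiouville`; crux `SpaceTimeLiouville := ∀ v adm, SRB-body(v) → InsertionResidue-body(v)`
(K1(v) ⇒ no insertion orthogonality catastrophe at v, ∀Θ∀Ψ form).

All theorems below are `sorry`-free structural facts (pure logic over LANDED tree theorems) recording where the
crux sits in the item graph.  Companion of `Cruxes/SpaceTimeLiouville/STRATEGY-CENSUS.md` §0.

* `target_imp_crux` — the rank-0 target `InsertionResidue` (13800) gives the crux by weakening (one line).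
* `target_of_crux_of_K1` — with the route's OTHER open crux K1 = `StaticResponseBound` (12057, certified
  no-strategy by seat cstrat-12057-p1) the crux gives the target back (= `responseLiouvilleGlue_proof`).
* `crux_iff_target_of_K1` — hence MODULO K1 the crux IS the target: `K1 → (SpaceTimeLiouville ↔ InsertionResidue)`.
* `periodicBEC_all_of_K1_crux` — and the target is at least the torus form of the summit: K1 ∧ crux ⊢ constant-mode
  BEC of periodic near-minimisers for EVERY admissible `v` (via the landed `ResidueCondensesAll_proof`).
* `correctorClosure_of_crux` — the crux implies the sibling crux `BECInsertionCorrector.CorrectorClosure`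
  (stmt-12058: K1 → ∃Θ-residue; 7 lines / 15 leads, all dead or reduced to `K1 ⇒ PeriodicBEC`), so every
  necessity result landed for 12058 (e.g. `periodicBEC_of_correctorClosure`, p121285) transfers to 13801.
* `periodicBEC_all_of_K1_crux'` — the same torus-BEC conclusion routed through the sibling's landed necessity theorem.

Reading: the only thing separating the crux from the (torus-)summit-strength target is the hypothesis K1, and K1 is
(a) itself summit-class open (sibling census) and (b) consumed by every known device only at first order / one loop
(STRATEGY-CENSUS §2–§4).  Nothing here is new mathematics; it is the bookkeeping the tribunal asked for.
-/

namespace Summit.AtomisticToContinuum.BoseEinsteinCondensation.Cruxes.SpaceTimeLiouville.Costume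

open MeasureTheory Filter
open scoped ENNReal NNReal ComplexConjugate
open Literature.MathematicalPhysics.QuantumManyBody.BoseGas
open Summit.AtomisticToContinuum.BoseEinsteinCondensation.Theses
open Summit.AtomisticToContinuum.BoseEinsteinCondensation.Theses.BECBathMassLiouville
open Summit.AtomisticToContinuum.BoseEinsteinCondensation.Theorems
open Summit.AtomisticToContinuum.BoseEinsteinCondensation.Theorems.CorrectorClosure.Negative

/-- The rank-0 target gives the crux by weakening: `IR → (K1-body(v) → IR-body(v))`. [folklore] -/
theorem target_imp_crux : InsertionResidue → SpaceTimeLiouville :=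
  fun hX v hv _ => hX v hv

/-- With K1 the crux returns the target (this is the landed glue `responseLiouvilleGlue_proof`). [folklore] -/
theorem target_of_crux_of_K1 (hK : StaticResponseBound) (hE : SpaceTimeLiouville) : InsertionResidue :=
  responseLiouvilleGlue_proof hK hE

/-- **Modulo K1 the crux is the target.** [folklore] -/
theorem crux_iff_target_of_K1 (hK : StaticResponseBound) : SpaceTimeLiouville ↔ InsertionResidue :=
  ⟨fun hE => target_of_crux_of_K1 hK hE, target_imp_crux⟩

/-- **K1 ∧ crux ⊢ torus BEC for every admissible `v`**: constant-mode condensation of periodic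
`δ`-near-minimisers on the torus of side `(N/ρ)^{1/3}`, `ρ < ρ₀(v)`, eventually in `N` — the `PeriodicBEC`
body that the shared transfer `BoundaryTransferWeak` (stmt-0827) turns into the Dirichlet conjunct.  This is
the first line of the route's `closes`, made a named theorem. [folklore] -/
theorem periodicBEC_all_of_K1_crux (hK : StaticResponseBound) (hE : SpaceTimeLiouville) :
    ∀ v : ℝ → ℝ≥0∞, IsRepulsiveFiniteRange v → ∃ ρ₀ : ℝ, 0 < ρ₀ ∧ ∀ ρ : ℝ, 0 < ρ → ρ < ρ₀ →
      ∃ c : ℝ, 0 < c ∧ ∀ᶠ N : ℕ in Filter.atTop, ∃ δ : ℝ≥0∞, 0 < δ ∧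
        ∀ Ψ : PeriodicTrialState N (sideLength ρ N),
          periodicEnergy v Ψ ≤ periodicGroundStateEnergy v N (sideLength ρ N) + δ →
          ENNReal.ofReal (c * N) ≤ condensateOccupation N (sideLength ρ N) Ψ.ψ :=
  fun v hv => ResidueCondensesAll_proof v hv (target_of_crux_of_K1 hK hE)

/-- **The crux implies the sibling crux** `CorrectorClosure := K1 → ∃Θ-InsertionResidue` of route
`BECInsertionCorrector` (stmt-AtomisticToContinuum-12058): the two K1 declarations are the same term
(`staticResponseBound_routes_agree`), and the ∀Θ∀Ψ residue gives the ∃Θ∀Ψ residue because near-minimisers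
exist at every positive slack (`exists_periodicEnergy_le_groundState_add`).  Hence everything shown NECESSARY
for 12058 is necessary for 13801. [folklore] -/
theorem correctorClosure_of_crux (hE : SpaceTimeLiouville) : BECInsertionCorrector.CorrectorClosure := by
  intro hK1 v hv
  have hK : StaticResponseBound := Summit.AtomisticToContinuum.BoseEinsteinCondensation.Theorems.StaticResponseBound.Negative.staticResponseBound_routes_agree.1 hK1
  obtain ⟨ρ₀, hρ₀, hρ⟩ := target_of_crux_of_K1 hK hE v hv
  refine ⟨ρ₀, hρ₀, fun ρ hρpos hρlt => ?_⟩
  obtain ⟨c, hc, hN⟩ := hρ ρ hρpos hρlt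
  refine ⟨c, hc, ?_⟩
  filter_upwards [hN] with N hN'
  obtain ⟨δ, hδ, hΘΨ⟩ := hN'
  have hL : 0 < sideLength ρ (N + 1) := sideLength_succ_pos hρpos N
  obtain ⟨Θ, hΘE⟩ := exists_periodicEnergy_le_groundState_add hL v hδ
  exact ⟨δ, hδ, Θ, hΘE, fun Ψ hΨE => hΘΨ Θ Ψ hΘE hΨE⟩

/-- The same torus-BEC conclusion, routed through the sibling's landed necessity theorem
`periodicBEC_of_correctorClosure` (p121285) — a cross-check that the two insertion routes pool here. [folklore] -/
theorem periodicBEC_all_of_K1_crux' (hK : StaticResponseBound) (hE : SpaceTimeLiouville) :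
    ∀ v : ℝ → ℝ≥0∞, IsRepulsiveFiniteRange v → ∃ ρ₀ : ℝ, 0 < ρ₀ ∧ ∀ ρ : ℝ, 0 < ρ → ρ < ρ₀ →
      ∃ c : ℝ, 0 < c ∧ ∀ᶠ N : ℕ in Filter.atTop, ∃ δ : ℝ≥0∞, 0 < δ ∧
        ∀ Ψ : PeriodicTrialState N (sideLength ρ N),
          periodicEnergy v Ψ ≤ periodicGroundStateEnergy v N (sideLength ρ N) + δ →
          ENNReal.ofReal (c * N) ≤ condensateOccupation N (sideLength ρ N) Ψ.ψ :=
  CorrectorClosure.ResidueAreaLaw.periodicBEC_of_correctorClosure (correctorClosure_of_crux hE)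
    (Summit.AtomisticToContinuum.BoseEinsteinCondensation.Theorems.StaticResponseBound.Negative.staticResponseBound_routes_agree.2 hK)

end Summit.AtomisticToContinuum.BoseEinsteinCondensation.Cruxes.SpaceTimeLiouville.Costume
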